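import Mathlib
import HarnessLib
import Literature.MathematicalPhysics.QuantumFieldTheory.ConstructiveQFTWave0
import Literature.MathematicalPhysics.QuantumLattice.AbelianFieldTensor
import Literature.MathematicalPhysics.QuantumLattice.AbelianMagneticFlux
import Summits.Ventures.LatticeQCDFlow.Scaling.TopologicalCollar
import Summits.Ventures.LatticeQCDFlow.Scaling.FluxSectorCollar
import Summits.Ventures.LatticeQCDFlow.Scaling.FluxPatch
import Summits.Ventures.LatticeQCDFlow.Scaling.SliceTwistWitness
import Summits.Ventures.LatticeQCDFlow.Scaling.RowFields

/-!
# Thin components ARE flux sectors: the `ε`-sectors of 2-d compact `U(1)` are Lüscher's flux sectors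

HONEST FRAMING: exact (Metropolis-corrected) sampling algorithms for lattice gauge theory;
figures of merit are autocorrelation/cost numbers at stated couplings and volumes; no
continuum-physics claim.

Venture `LatticeQCDFlow` (cell pub-lqcd), topic `Scaling`, FANOUT row 29 (theory2, gen-22), item 110.
NEW WORK over Mathlib and the tree's `Scaling/{TopologicalCollar, FluxSectorCollar, FluxPatch,
SliceTwistWitness, RowFields}`; nothing here is cited as a fact.  LITERATURE STATUS (honest): for
ADMISSIBLE fields (`|F| < ε` in angle, `0 < ε < π/3`, any dimension) the statement is KNOWN IN PRINT —
Lüscher decomposes the space of admissible abelian lattice gauge fields on the periodic lattice into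
magnetic-flux sectors, each "a multi-dimensional torus times a contractible space", hence connected
[Luscher1999AbelianChiral, §2.2 and Lemma 7.4]; his lattice field tensor is [Luscher1999AbelianTopology,
§3].  What is added here: `d = 2` at EVERY chordal threshold (the iff for all `ε ≤ 2`, i.e. plaquette
angles up to `π`, beyond the admissibility bound `π/3`; in `d = 2` there is no Bianchi constraint), an
explicit path inside the thin set, kernel-checked.  Grade: formalisation of a known mechanism plus a
range extension, not a new theorem of physics.

THE STATEMENT (conjecture C8 of the cell's THEORY-2 §4, now a theorem, in a form stronger than
conjectured).  `Thin L ε = {W | every plaquette of W is within chordal distance ε of 1}` is the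
`ε`-thin set of the metric tunnelling laws (`Scaling/SliceTwistWitness`), its connected components are
the `ε`-SECTORS that an exact local sampler must tunnel between, and `topCharge 0 0 1 W ∈ ℤ` is
Lüscher's flux charge (`Scaling/FluxSectorCollar`).  `Scaling/SliceTwistWitness` proved ONE inclusion:
for `ε ≤ 2` two thin configurations in the same `ε`-sector have the same charge.  Here the converse,
for EVERY `ε` and EVERY `L ≥ 1`:

* `mem_connectedComponentIn_thin_of_topCharge_eq`: two `ε`-thin configurations with the same flux
  charge lie in the same connected component of `Thin L ε`;
* `mem_connectedComponentIn_thin_iff`, `connectedComponentIn_thin_eq_iff` (`ε ≤ 2`): the `ε`-sectors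
  are EXACTLY the level sets of the flux charge on `Thin L ε`;
* `thinComponentsEqFluxSectors`: the conjecture C8 verbatim.

THE PROOF (no gauge fixing, no smallness of `ε`).  Lift the links, `U e = exp(i a_e)`; the plaquette
angle of the lift is `(da)(x) = F(x) + 2π m(x)` with `F = arg U_p ∈ (−π, π]` and `m(x) ∈ ℤ`, and
`Σ_x (da)(x) = 0`, so `Σ m = −Q(U)`.  Equal charges give `Σ_x (m'(x) − m(x)) = 0`, and the INTEGER
POINCARÉ LEMMA on the discrete torus (`exists_curl_eq`: an integer plaquette field of total zero is the
curl of an integer link field, proved by an explicit column-and-row primitive) corrects the lift of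
`U'` by `2π k`, `k` integer, so that both lifts have the SAME integer parts `m`.  Along the straight line
between the two lifts the plaquette angle at `x` is then `(1−t)F(x) + tF'(x)`, whose chord to `1` is at
most the larger of the two endpoint chords: the whole segment is `ε`-thin, and its image is connected.

CONSEQUENCE FOR THE BARRIER `TopologicalModeCollapse` (THEORY-2 §5): in `d = 2`, `U(1)`, the metric
obstruction (thin set disconnected) and the topological one (flux sectors) are the same obstruction —
there are no further "hidden" `ε`-sectors inside a flux sector, for any `ε`.

HONEST SCOPE: `U(1)`, `d = 2`, periodic `L × L` lattice, `L ≥ 1`; a statement about the TOPOLOGY of the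
thin set (path components), not about any measure, kernel or mixing time.
-/

noncomputable section

namespace Summit.Ventures.LatticeQCDFlow.Theory2.Lattice.Flux.ThinSectors

open Metric Set Filter Topology Real
open Literature.MathematicalPhysics.QuantumFieldTheory Literature.MathematicalPhysics.QuantumLattice

variable {L : ℕ}

/-! ## §1. Coordinates and sums on the two-dimensional discrete torus -/

/-- The site with coordinates `(i, j)`. [folklore] -/
def mkSite (i j : ZMod L) : Site 2 L := ![i, j]

/-- Every site is `mkSite` of its coordinates. [folklore] -/
theorem mkSite_eta (x : Site 2 L) : mkSite (x 0) (x 1) = x := by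
  ext t; fin_cases t <;> simp [mkSite]

/-- `(x + ê₀)₀ = x₀ + 1`. [folklore] -/
theorem shift_zero_apply_zero (x : Site 2 L) : x.shift 0 0 = x 0 + 1 := by
  simp [Site.shift]

/-- `(x + ê₀)₁ = x₁`. [folklore] -/
theorem shift_zero_apply_one (x : Site 2 L) : x.shift 0 1 = x 1 := by
  simp [Site.shift]

/-- `(x + ê₁)₀ = x₀`. [folklore] -/
theorem shift_one_apply_zero (x : Site 2 L) : x.shift 1 0 = x 0 := by
  simp [Site.shift]

/-- `(x + ê₁)₁ = x₁ + 1`. [folklore] -/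
theorem shift_one_apply_one (x : Site 2 L) : x.shift 1 1 = x 1 + 1 := by
  simp [Site.shift]

/-- Sums over the torus in coordinates. [folklore] -/
theorem sum_site_eq [NeZero L] {M : Type*} [AddCommMonoid M] (f : Site 2 L → M) :
    ∑ x, f x = ∑ i : ZMod L, ∑ j : ZMod L, f (mkSite i j) := by
  rw [Fintype.sum_equiv (piFinTwoEquiv fun _ => ZMod L) f (fun ab => f (mkSite ab.1 ab.2))
    (fun x => congrArg f (mkSite_eta x).symm), Fintype.sum_prod_type]

/-- Sums over `ZMod L` of functions of the representative are sums over `range L`. [folklore] -/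
theorem sum_zmod_val_eq [NeZero L] {M : Type*} [AddCommMonoid M] (g : ℕ → M) :
    ∑ t : ZMod L, g t.val = ∑ i ∈ Finset.range L, g i := by
  obtain ⟨n, hn⟩ : ∃ n, L = n + 1 := ⟨L - 1, by have := Nat.pos_of_ne_zero (NeZero.ne L); omega⟩
  subst hn
  exact Fin.sum_univ_eq_sum_range (fun i => g i) (n + 1)

/-- Sums over `range L` of a function on `ZMod L` (through the cast) are sums over `ZMod L`. [folklore] -/
theorem sum_range_cast_eq [NeZero L] {M : Type*} [AddCommMonoid M] (g : ZMod L → M) :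
    ∑ i ∈ Finset.range L, g (i : ZMod L) = ∑ j : ZMod L, g j := by
  have h := sum_zmod_val_eq (L := L) (fun i => g (i : ZMod L))
  simp only [ZMod.natCast_zmod_val] at h
  exact h.symm

/-- The representative of `j + 1`: `(j + 1).val = (j.val + 1) mod L`. [folklore] -/
theorem val_add_one_eq_mod [NeZero L] (j : ZMod L) : (j + 1).val = (j.val + 1) % L := by
  rw [ZMod.val_add, ZMod.val_one_eq_one_mod, Nat.add_mod_mod]

/-! ## §2. The lattice curl and the plaquette angle of a lifted configuration -/

/-- The lattice curl (plaquette coboundary) of an additive link field in two dimensions: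
`(dk)(x) = k(x,0) + k(x+ê₀,1) − k(x+ê₁,0) − k(x,1)`. [folklore] -/
def curl {A : Type*} [AddCommGroup A] (k : Edge 2 L → A) (x : Site 2 L) : A :=
  k (x, 0) + k (x.shift 0, 1) - k (x.shift 1, 0) - k (x, 1)

/-- The curl is affine along segments of link fields. [folklore] -/
theorem curl_lineComb (a b : Edge 2 L → ℝ) (t : ℝ) (x : Site 2 L) :
    curl (fun e => a e + t * (b e - a e)) x = curl a x + t * (curl b x - curl a x) := by
  simp only [curl]; ring

/-- The curl of a lift corrected by `c·k`, `k` integer. [folklore] -/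
theorem curl_sub_const_mul (a : Edge 2 L → ℝ) (k : Edge 2 L → ℤ) (c : ℝ) (x : Site 2 L) :
    curl (fun e => a e - c * k e) x = curl a x - c * curl k x := by
  simp only [curl]; push_cast; ring

/-- The total curl over the torus vanishes (every link bounds two plaquettes with opposite signs).
[folklore] -/
theorem sum_curl_eq_zero [NeZero L] {A : Type*} [AddCommGroup A] (k : Edge 2 L → A) :
    ∑ x, curl k x = 0 := by
  simp only [curl, Finset.sum_sub_distrib, Finset.sum_add_distrib]
  have h0 : ∑ x : Site 2 L, k (x.shift 0, 1) = ∑ x : Site 2 L, k (x, 1) :=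
    Fintype.sum_equiv (Equiv.addRight (Pi.single 0 1)) _ _ fun _ => rfl
  have h1 : ∑ x : Site 2 L, k (x.shift 1, 0) = ∑ x : Site 2 L, k (x, 0) :=
    Fintype.sum_equiv (Equiv.addRight (Pi.single 1 1)) _ _ fun _ => rfl
  rw [h0, h1]; abel

/-- The plaquette of an exponentiated link field is the exponential of its curl (the group is
abelian). [folklore] -/
theorem plaquetteHolonomy_exp (a : Edge 2 L → ℝ) (x : Site 2 L) :
    plaquetteHolonomy (fun e => Circle.exp (a e)) x 0 1 = Circle.exp (curl a x) := by
  have h : curl a x = a (x, 0) + a (x.shift 0, 1) + -a (x.shift 1, 0) + -a (x, 1) := by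
    simp only [curl]; ring
  rw [h]
  simp only [plaquetteHolonomy, Circle.exp_add, Circle.exp_neg]

/-- The plaquette of `U` through a lift `a` (`exp(i a_e) = U_e`). [folklore] -/
theorem plaquetteHolonomy_eq_exp_curl {U : GaugeConfig 2 L Circle} {a : Edge 2 L → ℝ}
    (ha : ∀ e, Circle.exp (a e) = U e) (x : Site 2 L) :
    plaquetteHolonomy U x 0 1 = Circle.exp (curl a x) := by
  rw [show U = fun e => Circle.exp (a e) from funext fun e => (ha e).symm]
  exact plaquetteHolonomy_exp a x

/-- The plaquette angle of a lift is the field tensor plus an INTEGER multiple of `2π`: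
`(da)(x) = F(x) + 2π m(x)`. [cite: Luscher1999AbelianTopology, eq. (3.4)] [folklore] -/
theorem exists_int_curl_eq {U : GaugeConfig 2 L Circle} {a : Edge 2 L → ℝ}
    (ha : ∀ e, Circle.exp (a e) = U e) (x : Site 2 L) :
    ∃ m : ℤ, curl a x = abelianFieldTensor U x 0 1 + m * (2 * π) :=
  Circle.exp_eq_exp.mp (by rw [← plaquetteHolonomy_eq_exp_curl ha, exp_abelianFieldTensor])

/-- The field tensor summed over the torus is the magnetic flux through the `(0,1)`-plane.
[cite: Luscher1999AbelianChiral, §2.2, eq. (2.10)] [folklore] -/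
theorem sum_abelianFieldTensor_eq_magneticFlux [NeZero L] (U : GaugeConfig 2 L Circle) :
    ∑ x : Site 2 L, abelianFieldTensor U x 0 1 = magneticFlux U 0 0 1 := by
  rw [magneticFlux, sum_site_eq]
  refine Finset.sum_congr rfl fun s _ => Finset.sum_congr rfl fun t _ => ?_
  congr 1
  ext i; fin_cases i <;> simp [mkSite]

/-! ## §3. The integer Poincaré lemma on the discrete torus -/

/-- **One dimension.** An integer function on the cycle `ℤ/L` with total zero is a difference:
`g(j) = h(j) − h(j+1)` (explicit primitive `h(j) = −Σ_{i<j} g(i)`). [folklore] -/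
theorem exists_eq_sub_of_sum_eq_zero [NeZero L] (g : ZMod L → ℤ) (hg : ∑ j, g j = 0) :
    ∃ h : ZMod L → ℤ, ∀ j, g j = h j - h (j + 1) := by
  refine ⟨fun j => -∑ i ∈ Finset.range j.val, g i, fun j => ?_⟩
  dsimp only
  have hlt : j.val < L := ZMod.val_lt j
  by_cases hj : j.val + 1 < L
  · rw [val_add_one_eq_mod, Nat.mod_eq_of_lt hj, Finset.sum_range_succ, ZMod.natCast_zmod_val]
    ring
  · have hL : j.val + 1 = L := by omega
    rw [val_add_one_eq_mod, hL, Nat.mod_self, Finset.sum_range_zero, neg_zero, sub_zero]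
    have htot : ∑ i ∈ Finset.range (j.val + 1), g (i : ZMod L) = 0 := by
      rw [hL, sum_range_cast_eq, hg]
    rw [Finset.sum_range_succ, ZMod.natCast_zmod_val] at htot
    linarith

/-- **Two dimensions (the integer Poincaré lemma on the torus).**  An integer plaquette field on the
periodic `L × L` lattice with total zero is the curl of an integer link field.  Explicit primitive:
within each column the direction-`0` links telescope the column (minus its total, dumped on the row
`x₁ = 0`), and the direction-`1` links of that row telescope the column totals, whose sum is the
hypothesis. [folklore] -/
theorem exists_curl_eq [NeZero L] (n : Site 2 L → ℤ) (hn : ∑ x, n x = 0) :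
    ∃ k : Edge 2 L → ℤ, ∀ x, curl k x = n x := by
  obtain ⟨c, hc⟩ : ∃ c : ZMod L → ℤ, ∀ i, c i = ∑ j, n (mkSite i j) := ⟨_, fun _ => rfl⟩
  have hcsum : ∑ i, c i = 0 :=
    calc ∑ i, c i = ∑ i, ∑ j, n (mkSite i j) := Finset.sum_congr rfl fun i _ => hc i
      _ = ∑ x, n x := (sum_site_eq n).symm
      _ = 0 := hn
  have hcol : ∀ i, ∃ h : ZMod L → ℤ, ∀ j,
      (n (mkSite i j) - if j = 0 then c i else 0) = h j - h (j + 1) := fun i =>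
    exists_eq_sub_of_sum_eq_zero _ (by
      rw [Finset.sum_sub_distrib, Finset.sum_ite_eq', if_pos (Finset.mem_univ _), hc, sub_self])
  choose h₁ hh₁ using hcol
  obtain ⟨h₂, hh₂⟩ : ∃ h₂ : ZMod L → ℤ, ∀ i, -c i = h₂ i - h₂ (i + 1) :=
    exists_eq_sub_of_sum_eq_zero (fun i => -c i) (by rw [Finset.sum_neg_distrib, hcsum, neg_zero])
  refine ⟨fun e => ![h₁ (e.1 0) (e.1 1), if e.1 1 = 0 then h₂ (e.1 0) else 0] e.2, fun x => ?_⟩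
  have e1 := hh₁ (x 0) (x 1)
  have e2 := hh₂ (x 0)
  rw [mkSite_eta] at e1
  simp only [curl, Matrix.cons_val_zero, Matrix.cons_val_one,
    shift_zero_apply_zero, shift_zero_apply_one, shift_one_apply_zero, shift_one_apply_one]
  by_cases hx : x 1 = 0
  · simp only [if_pos hx] at e1 ⊢
    linear_combination e2 - e1
  · simp only [if_neg hx] at e1 ⊢
    linear_combination -e1

/-! ## §4. Chord control along a segment of plaquette angles -/

/-- A convex combination of two angles is no larger than the larger one. [folklore] -/
theorem abs_lineComb_le {u v t : ℝ} (ht : t ∈ Icc (0 : ℝ) 1) : |u + t * (v - u)| ≤ max |u| |v| := by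
  have h1 : u + t * (v - u) = (1 - t) * u + t * v := by ring
  rw [h1]
  calc |(1 - t) * u + t * v| ≤ |(1 - t) * u| + |t * v| := abs_add_le _ _
    _ = (1 - t) * |u| + t * |v| := by
        rw [abs_mul, abs_mul, abs_of_nonneg (sub_nonneg.mpr ht.2), abs_of_nonneg ht.1]
    _ ≤ (1 - t) * max |u| |v| + t * max |u| |v| :=
        add_le_add (mul_le_mul_of_nonneg_left (le_max_left _ _) (sub_nonneg.mpr ht.2))
          (mul_le_mul_of_nonneg_left (le_max_right _ _) ht.1)
    _ = max |u| |v| := by ring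

/-- The chord to `1` is monotone in the size of the angle on `[−π, π]`. [folklore] -/
theorem dist_exp_one_mono_abs {θ φ : ℝ} (h : |θ| ≤ |φ|) (hφ : |φ| ≤ π) :
    dist (Circle.exp θ) 1 ≤ dist (Circle.exp φ) 1 := by
  rw [dist_exp_one_eq, dist_exp_one_eq, abs_mul, abs_mul]
  refine mul_le_mul_of_nonneg_left (abs_sin_le_abs_sin ?_ ?_) (abs_nonneg _)
  · rw [abs_div, abs_div, abs_two]; linarith
  · rw [abs_div, abs_two]; linarith

/-- Along the segment of plaquette angles `(1−t)F + tF'` the plaquette stays at least as close to `1`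
as the farther endpoint plaquette. [folklore] -/
theorem dist_exp_lineComb_one_le (U U' : GaugeConfig 2 L Circle) (x : Site 2 L) {t : ℝ}
    (ht : t ∈ Icc (0 : ℝ) 1) :
    dist (Circle.exp (abelianFieldTensor U x 0 1 +
        t * (abelianFieldTensor U' x 0 1 - abelianFieldTensor U x 0 1))) 1 ≤
      max (dist (plaquetteHolonomy U x 0 1) 1) (dist (plaquetteHolonomy U' x 0 1) 1) := by
  rcases le_total |abelianFieldTensor U x 0 1| |abelianFieldTensor U' x 0 1| with hle | hle
  · refine le_trans ?_ (le_max_right _ _)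
    rw [← exp_abelianFieldTensor U']
    exact dist_exp_one_mono_abs ((abs_lineComb_le ht).trans (max_eq_right hle).le)
      (abs_abelianFieldTensor_le_pi U' x 0 1)
  · refine le_trans ?_ (le_max_left _ _)
    rw [← exp_abelianFieldTensor U]
    exact dist_exp_one_mono_abs ((abs_lineComb_le ht).trans (max_eq_left hle).le)
      (abs_abelianFieldTensor_le_pi U x 0 1)

/-! ## §5. Thin components are flux sectors -/

/-- **Same flux charge ⇒ same `ε`-sector** (every `ε`, every `L ≥ 1`).  Two `ε`-thin `U(1)`
configurations on the periodic `L × L` lattice with the same flux charge lie in the same connected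
component of the `ε`-thin set. [cite: Luscher1999AbelianChiral, §7] [folklore] -/
theorem mem_connectedComponentIn_thin_of_topCharge_eq [NeZero L] {ε : ℝ}
    {U U' : GaugeConfig 2 L Circle} (hU : U ∈ Thin L ε) (hU' : U' ∈ Thin L ε)
    (hQ : topCharge (0 : Site 2 L) 0 1 U = topCharge (0 : Site 2 L) 0 1 U') :
    U' ∈ connectedComponentIn (Thin L ε) U := by
  -- lifts of the links
  obtain ⟨a, ha⟩ : ∃ a : Edge 2 L → ℝ, ∀ e, Circle.exp (a e) = U e :=
    ⟨fun e => Complex.arg (U e : ℂ), fun e => Circle.exp_arg (U e)⟩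
  obtain ⟨a', ha'⟩ : ∃ a' : Edge 2 L → ℝ, ∀ e, Circle.exp (a' e) = U' e :=
    ⟨fun e => Complex.arg (U' e : ℂ), fun e => Circle.exp_arg (U' e)⟩
  -- integer parts of the plaquette angles of the lifts
  choose m hm using fun x => exists_int_curl_eq ha x
  choose m' hm' using fun x => exists_int_curl_eq ha' x
  -- equal charges: the integer parts have the same total
  have hflux : magneticFlux U 0 0 1 = magneticFlux U' 0 0 1 := by
    have hπ : (2 : ℝ) * π ≠ 0 := by positivity
    exact (div_left_inj' hπ).mp hQ
  have h1 : ∑ x, curl a x = 0 := sum_curl_eq_zero a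
  have h2 : ∑ x, curl a' x = 0 := sum_curl_eq_zero a'
  simp only [hm, hm', Finset.sum_add_distrib, ← Finset.sum_mul, sum_abelianFieldTensor_eq_magneticFlux] at h1 h2
  have h3 : ((∑ x, (m' x : ℝ)) - ∑ x, (m x : ℝ)) * (2 * π) = 0 := by
    linear_combination h2 - h1 + hflux
  have h4 : (∑ x, (m' x : ℝ)) - ∑ x, (m x : ℝ) = 0 :=
    (mul_eq_zero.mp h3).resolve_right (by positivity)
  have hsum : ∑ x, (m' x - m x) = 0 := by
    rw [Finset.sum_sub_distrib]
    exact_mod_cast h4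
  -- the integer Poincaré lemma corrects the second lift to the same integer parts
  obtain ⟨k, hk⟩ : ∃ k : Edge 2 L → ℤ, ∀ x, curl k x = m' x - m x :=
    exists_curl_eq (fun x => m' x - m x) hsum
  obtain ⟨a'', ha''_def⟩ : ∃ a'' : Edge 2 L → ℝ, ∀ e, a'' e = a' e - (2 * π) * k e :=
    ⟨_, fun _ => rfl⟩
  have ha'' : ∀ e, Circle.exp (a'' e) = U' e := fun e => by
    rw [← ha' e, ha''_def]
    exact Circle.exp_eq_exp.mpr ⟨-k e, by push_cast; ring⟩
  have hcurl'' : ∀ x, curl a'' x = abelianFieldTensor U' x 0 1 + m x * (2 * π) := fun x => by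
    rw [show a'' = fun e => a' e - (2 * π) * k e from funext ha''_def, curl_sub_const_mul,
      hm' x, hk x]
    push_cast; ring
  -- the segment between the two lifts, exponentiated
  obtain ⟨γ, hγ⟩ : ∃ γ : ℝ → GaugeConfig 2 L Circle,
      γ = fun t e => Circle.exp (a e + t * (a'' e - a e)) := ⟨_, rfl⟩
  have hγ0 : γ 0 = U := by
    rw [hγ]; funext e
    show Circle.exp (a e + 0 * (a'' e - a e)) = U e
    rw [← ha e]; congr 1; ring
  have hγ1 : γ 1 = U' := by
    rw [hγ]; funext e
    show Circle.exp (a e + 1 * (a'' e - a e)) = U' e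
    rw [← ha'' e]; congr 1; ring
  have hγc : Continuous γ := by
    rw [hγ]
    refine continuous_pi fun e => ?_
    have hc : Continuous fun t : ℝ => a e + t * (a'' e - a e) := by fun_prop
    exact Circle.exp.continuous.comp hc
  have hγthin : ∀ t ∈ Icc (0 : ℝ) 1, γ t ∈ Thin L ε := by
    intro t ht p
    obtain ⟨h0, h1⟩ := plaquette_dirs_eq p
    rw [h0, h1]
    have hp : plaquetteHolonomy (γ t) p.1 0 1 = Circle.exp (abelianFieldTensor U p.1 0 1 +
        t * (abelianFieldTensor U' p.1 0 1 - abelianFieldTensor U p.1 0 1)) := by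
      rw [hγ, plaquetteHolonomy_exp, curl_lineComb, hm, hcurl'']
      exact Circle.exp_eq_exp.mpr ⟨m p.1, by ring⟩
    rw [hp]
    refine (dist_exp_lineComb_one_le U U' p.1 ht).trans_lt (max_lt ?_ ?_)
    · have h := hU p; rwa [h0, h1] at h
    · have h := hU' p; rwa [h0, h1] at h
  -- a connected subset of the thin set containing both endpoints
  have hpre : IsPreconnected (γ '' Icc 0 1) := isPreconnected_Icc.image γ hγc.continuousOn
  have hsub : γ '' Icc 0 1 ⊆ Thin L ε := by
    rintro _ ⟨t, ht, rfl⟩; exact hγthin t ht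
  exact hpre.subset_connectedComponentIn ⟨0, ⟨le_rfl, zero_le_one⟩, hγ0⟩ hsub
    ⟨1, ⟨zero_le_one, le_rfl⟩, hγ1⟩

/-- **The `ε`-sectors are exactly the flux sectors** (`ε ≤ 2`): two `ε`-thin configurations lie in the
same connected component of `Thin L ε` iff they have the same flux charge.
[cite: Luscher1999AbelianChiral, §7] [folklore] -/
theorem mem_connectedComponentIn_thin_iff [NeZero L] {ε : ℝ} (hε : ε ≤ 2)
    {U U' : GaugeConfig 2 L Circle} (hU : U ∈ Thin L ε) (hU' : U' ∈ Thin L ε) :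
    U' ∈ connectedComponentIn (Thin L ε) U ↔
      topCharge (0 : Site 2 L) 0 1 U' = topCharge (0 : Site 2 L) 0 1 U :=
  ⟨fun h => topCharge_eq_of_mem_connectedComponentIn hε (0 : Site 2 L) (μ := 0) (ν := 1)
      (by decide) h,
    fun h => mem_connectedComponentIn_thin_of_topCharge_eq hU hU' h.symm⟩

/-- **Sector equality is charge equality** (`ε ≤ 2`): the `ε`-sectors of two thin configurations
coincide iff their flux charges do. [cite: Luscher1999AbelianChiral, §7] [folklore] -/
theorem connectedComponentIn_thin_eq_iff [NeZero L] {ε : ℝ} (hε : ε ≤ 2)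
    {U U' : GaugeConfig 2 L Circle} (hU : U ∈ Thin L ε) (hU' : U' ∈ Thin L ε) :
    connectedComponentIn (Thin L ε) U = connectedComponentIn (Thin L ε) U' ↔
      topCharge (0 : Site 2 L) 0 1 U = topCharge (0 : Site 2 L) 0 1 U' := by
  constructor
  · intro h
    have hU'mem : U' ∈ connectedComponentIn (Thin L ε) U := by
      rw [h]; exact mem_connectedComponentIn hU'
    exact ((mem_connectedComponentIn_thin_iff hε hU hU').mp hU'mem).symm
  · intro h
    exact connectedComponentIn_eq (mem_connectedComponentIn_thin_of_topCharge_eq hU hU' h)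

/-- Conjecture C8 of the cell's THEORY-2 §4, verbatim: THIN COMPONENTS = FLUX SECTORS. [folklore] -/
def ThinComponentsEqFluxSectors (L : ℕ) [NeZero L] : Prop :=
  ∀ ε : ℝ, 0 < ε → ε < 2 → ∀ U U' : GaugeConfig 2 L Circle, U ∈ Thin L ε → U' ∈ Thin L ε →
    topCharge (0 : Site 2 L) 0 1 U = topCharge (0 : Site 2 L) 0 1 U' →
      U' ∈ connectedComponentIn (Thin L ε) U

/-- **C8 holds** for every `L ≥ 1` (and the hypotheses `0 < ε < 2` are not needed). [folklore] -/
theorem thinComponentsEqFluxSectors (L : ℕ) [NeZero L] : ThinComponentsEqFluxSectors L :=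
  fun _ _ _ _ _ hU hU' hQ => mem_connectedComponentIn_thin_of_topCharge_eq hU hU' hQ

end Summit.Ventures.LatticeQCDFlow.Theory2.Lattice.Flux.ThinSectors

end
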